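import Summits.HubbardSuperconductivity.HubbardSuperconductivity.Theorems.AnisotropyChordInsertionEntropySheetCorrelations

/-!
# Route `AnisotropyChord` / H0 rotor rung: weighted covariance toolkit for `μ(σ) = a(σ)²/Z`
# (port of theory seat `hubbard-h0-rotor-theory-1`, Sketch9 Part O, generic half, memo ROTOR-THEORY-9 §135(s))

`wcov`, `wvar`: centring, weighted Cauchy–Schwarz `cov(f,g)² ≤ var f · var g`, `var(f+g+h) ≤ 3(var f + var g + var h)`,
`var(tf) = t² var f`, `var f ≤ μ(f²)`, `cov(f, Σ tᵢgᵢ) = Σ tᵢ cov(f,gᵢ)`, and the two links to the two-defect problem: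
`P[n_z = 1 | x occ., y empty] − ρ_z = cov(1_A, n_z)/μ(A)` and `var 1_A ≤ μ(A)` for the particle–hole event `A`.
-/

set_option linter.dupNamespace false

noncomputable section

open Finset

namespace Summit.HubbardSuperconductivity.HubbardSuperconductivity.Theorems.AnisotropyChord.InsertionEntropy

section SheetCovariance

variable {V : Type} [Fintype V] [DecidableEq V]

/-- Covariance `cov(f,g) = μ(fg) − μ(f)μ(g)`. (theory seat Sketch9 Part O) [folklore] -/
def wcov (a : (V → Fin 2) → ℝ) (f g : (V → Fin 2) → ℝ) : ℝ :=
  wmean a (fun σ => f σ * g σ) - wmean a f * wmean a g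

/-- Variance `var f = cov(f,f)`. (theory seat Sketch9 Part O) [folklore] -/
def wvar (a : (V → Fin 2) → ℝ) (f : (V → Fin 2) → ℝ) : ℝ := wcov a f f

/-- Centred form of the covariance (`Z ≠ 0`). [folklore] -/
theorem wcov_eq_centered (a : (V → Fin 2) → ℝ) (f g : (V → Fin 2) → ℝ) (hZ : wnorm a ≠ 0) :
    wcov a f g = wmean a (fun σ => (f σ - wmean a f) * (g σ - wmean a g)) := by
  have : (fun σ => (f σ - wmean a f) * (g σ - wmean a g))
      = fun σ => f σ * g σ + ((- wmean a g) * f σ + ((- wmean a f) * g σ + wmean a f * wmean a g)) := by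
    funext σ; ring
  rw [this, wmean_add, wmean_add, wmean_add, wmean_smul, wmean_smul, wmean_const a _ hZ]
  unfold wcov; ring

/-- Centred form of the variance (`Z ≠ 0`). [folklore] -/
theorem wvar_eq_centered (a : (V → Fin 2) → ℝ) (f : (V → Fin 2) → ℝ) (hZ : wnorm a ≠ 0) :
    wvar a f = wmean a (fun σ => (f σ - wmean a f) ^ 2) := by
  unfold wvar; rw [wcov_eq_centered a f f hZ]; exact wmean_congr a fun σ => by ring

/-- `var ≥ 0` (`Z ≠ 0`). [folklore] -/
theorem wvar_nonneg (a : (V → Fin 2) → ℝ) (f : (V → Fin 2) → ℝ) (hZ : wnorm a ≠ 0) : 0 ≤ wvar a f := by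
  rw [wvar_eq_centered a f hZ]; exact wmean_nonneg a fun σ => sq_nonneg _

/-- Cauchy–Schwarz for weighted sums. [folklore] -/
theorem wsum_mul_sq_le (a : (V → Fin 2) → ℝ) (φ ψ : (V → Fin 2) → ℝ) :
    wsum a (fun σ => φ σ * ψ σ) ^ 2 ≤ wsum a (fun σ => φ σ * φ σ) * wsum a (fun σ => ψ σ * ψ σ) := by
  unfold wsum
  have h := Finset.sum_mul_sq_le_sq_mul_sq Finset.univ (fun σ => a σ * φ σ) (fun σ => a σ * ψ σ)
  have e1 : ∑ σ, a σ ^ 2 * (φ σ * ψ σ) = ∑ σ, (a σ * φ σ) * (a σ * ψ σ) :=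
    Finset.sum_congr rfl fun σ _ => by ring
  have e2 : ∑ σ, a σ ^ 2 * (φ σ * φ σ) = ∑ σ, (a σ * φ σ) ^ 2 := Finset.sum_congr rfl fun σ _ => by ring
  have e3 : ∑ σ, a σ ^ 2 * (ψ σ * ψ σ) = ∑ σ, (a σ * ψ σ) ^ 2 := Finset.sum_congr rfl fun σ _ => by ring
  rw [e1, e2, e3]; exact h

/-- Cauchy–Schwarz for weighted means. [folklore] -/
theorem wmean_mul_sq_le (a : (V → Fin 2) → ℝ) (φ ψ : (V → Fin 2) → ℝ) :
    wmean a (fun σ => φ σ * ψ σ) ^ 2 ≤ wmean a (fun σ => φ σ * φ σ) * wmean a (fun σ => ψ σ * ψ σ) := by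
  unfold wmean
  rw [div_pow, div_mul_div_comm, ← sq]
  exact div_le_div_of_nonneg_right (wsum_mul_sq_le a φ ψ) (sq_nonneg _)

/-- **Weighted Cauchy–Schwarz:** `cov(f,g)² ≤ var f · var g` (`Z ≠ 0`). (theory seat Sketch9 Part O) [folklore] -/
theorem wcov_sq_le_wvar_mul_wvar (a : (V → Fin 2) → ℝ) (f g : (V → Fin 2) → ℝ) (hZ : wnorm a ≠ 0) :
    wcov a f g ^ 2 ≤ wvar a f * wvar a g := by
  unfold wvar
  rw [wcov_eq_centered a f g hZ, wcov_eq_centered a f f hZ, wcov_eq_centered a g g hZ]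
  exact wmean_mul_sq_le a _ _

/-- `var(f+g+h) ≤ 3(var f + var g + var h)` (`Z ≠ 0`). (theory seat Sketch9 Part O) [folklore] -/
theorem wvar_add_three_le (a : (V → Fin 2) → ℝ) (f g h : (V → Fin 2) → ℝ) (hZ : wnorm a ≠ 0) :
    wvar a (fun σ => f σ + g σ + h σ) ≤ 3 * (wvar a f + wvar a g + wvar a h) := by
  rw [wvar_eq_centered a _ hZ, wvar_eq_centered a f hZ, wvar_eq_centered a g hZ, wvar_eq_centered a h hZ]
  have hm : wmean a (fun σ => f σ + g σ + h σ) = wmean a f + wmean a g + wmean a h := by rw [wmean_add, wmean_add]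
  rw [hm]
  calc wmean a (fun σ => (f σ + g σ + h σ - (wmean a f + wmean a g + wmean a h)) ^ 2)
      ≤ wmean a (fun σ => 3 * ((f σ - wmean a f) ^ 2 + (g σ - wmean a g) ^ 2 + (h σ - wmean a h) ^ 2)) :=
        wmean_mono a fun σ => by
          nlinarith [sq_nonneg ((f σ - wmean a f) - (g σ - wmean a g)),
            sq_nonneg ((g σ - wmean a g) - (h σ - wmean a h)), sq_nonneg ((f σ - wmean a f) - (h σ - wmean a h))]
    _ = 3 * (wmean a (fun σ => (f σ - wmean a f) ^ 2) + wmean a (fun σ => (g σ - wmean a g) ^ 2)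
          + wmean a (fun σ => (h σ - wmean a h) ^ 2)) := by
        rw [wmean_smul, wmean_add, wmean_add]

/-- `var(t f) = t² var f`. [folklore] -/
theorem wvar_smul (a : (V → Fin 2) → ℝ) (t : ℝ) (f : (V → Fin 2) → ℝ) :
    wvar a (fun σ => t * f σ) = t ^ 2 * wvar a f := by
  unfold wvar wcov
  rw [show (fun σ => t * f σ * (t * f σ)) = (fun σ => t ^ 2 * (f σ * f σ)) from funext fun σ => by ring,
    wmean_smul, wmean_smul]
  ring

/-- `var f ≤ μ(f²)`. [folklore] -/
theorem wvar_le_wmean_sq (a : (V → Fin 2) → ℝ) (f : (V → Fin 2) → ℝ) :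
    wvar a f ≤ wmean a (fun σ => f σ ^ 2) := by
  unfold wvar wcov
  have : wmean a (fun σ => f σ * f σ) = wmean a (fun σ => f σ ^ 2) := wmean_congr a fun σ => by ring
  rw [this]; nlinarith [sq_nonneg (wmean a f)]

/-- `cov(f, Σ_i t_i g_i) = Σ_i t_i cov(f, g_i)`. [folklore] -/
theorem wcov_sum_right (a : (V → Fin 2) → ℝ) (f : (V → Fin 2) → ℝ) {ι : Type} (s : Finset ι) (t : ι → ℝ)
    (g : ι → (V → Fin 2) → ℝ) :
    wcov a f (fun σ => ∑ i ∈ s, t i * g i σ) = ∑ i ∈ s, t i * wcov a f (g i) := by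
  unfold wcov
  have e1 : wmean a (fun σ => f σ * ∑ i ∈ s, t i * g i σ) = ∑ i ∈ s, t i * wmean a (fun σ => f σ * g i σ) := by
    rw [show (fun σ => f σ * ∑ i ∈ s, t i * g i σ) = (fun σ => ∑ i ∈ s, t i * (f σ * g i σ)) from
      funext fun σ => by rw [Finset.mul_sum]; exact Finset.sum_congr rfl fun i _ => by ring]
    rw [wmean_finset_sum]; exact Finset.sum_congr rfl fun i _ => wmean_smul a _ _
  have e2 : wmean a (fun σ => ∑ i ∈ s, t i * g i σ) = ∑ i ∈ s, t i * wmean a (g i) := by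
    rw [wmean_finset_sum]; exact Finset.sum_congr rfl fun i _ => wmean_smul a _ _
  rw [e1, e2, Finset.mul_sum, ← Finset.sum_sub_distrib]
  exact Finset.sum_congr rfl fun i _ => by ring

/-- `P[n_z = 1 | x occupied, y empty] − ρ_z = cov(1_A, n_z)/μ(A)` (`z ≠ x`, `A = {x occupied, y empty}`).
(theory seat Sketch9 Part O `condOcc_sub_dens_eq_cov`) [folklore] -/
theorem condOcc_sub_dens_eq_wcov (a : (V → Fin 2) → ℝ) (x y z : V) (hxy : x ≠ y) (hzx : z ≠ x)
    (hZ : wnorm a ≠ 0) (hpm : pairMass a x y ≠ 0) :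
    condOcc a x y z - dens a z
      = wcov a (fun σ => occ σ x * (1 - occ σ y)) (fun σ => occ σ z) / probPH a x y := by
  have hD : probPH a x y ≠ 0 := by rw [probPH_eq a x y hxy]; exact div_ne_zero hpm hZ
  have hcond : condOcc a x y z = wmean a (fun σ => occ σ x * (1 - occ σ y) * occ σ z) / probPH a x y := by
    rw [probPH_eq a x y hxy]
    unfold wmean
    rw [← condOcc_mul_pairMass a x y z hxy hzx hpm]
    field_simp
  rw [hcond]
  unfold wcov dens
  unfold probPH at hD ⊢
  field_simp

/-- `var 1_A ≤ μ(A)` for the particle–hole indicator. (theory seat Sketch9 Part O) [folklore] -/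
theorem wvar_probPH_le (a : (V → Fin 2) → ℝ) (x y : V) :
    wvar a (fun σ => occ σ x * (1 - occ σ y)) ≤ probPH a x y := by
  refine (wvar_le_wmean_sq a _).trans (le_of_eq ?_)
  unfold probPH
  refine wmean_congr a fun σ => ?_
  have hx : occ σ x * occ σ x = occ σ x := by unfold occ; split_ifs <;> simp
  have hy : occ σ y * occ σ y = occ σ y := by unfold occ; split_ifs <;> simp
  linear_combination (1 - occ σ y) ^ 2 * hx + occ σ x * hy

end SheetCovariance

end Summit.HubbardSuperconductivity.HubbardSuperconductivity.Theorems.AnisotropyChord.InsertionEntropy
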